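import Summits.ResolutionOfSingularities.ResolutionOfSingularities.Theorems.HilbertSamuelEliminationSigmaMaxModificationsCorridor3WLadderGradeOneUnits
import Summits.ResolutionOfSingularities.ResolutionOfSingularities.Theorems.HilbertSamuelEliminationSigmaMaxModificationsCorridor3WLadderMovingIsoLowQ
import Literature.AlgebraicGeometry.Resolution.PermissibleBlowupDirectrixRational
import HarnessLib

/-!
# [OURS · L1 W4.2] THE THIRD-DOOR SOCKET `IsoLowDirDimTerminatesQM p` of `stub_Wlow3M_char`, modulo the printed facts
# (CJS Thm. 3.14, Thm. 3.10 (4), Cor. 6.37) and two LIB binders (crux chain w42, line `w_ladder`;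
# `--supports stmt-ResolutionOfSingularities-19249`, helper)

OURS (cell res-hironaka, slot W4.2, seat res-L1-w42-stub-2 gen 3); NOT statements of H. Hironaka's manuscript
[Hironaka2017]. AI-drafted, weaker than expert review. Sorry-free PROOF file (no new definition).

`Moving.isoLowDirDimTerminatesQM_of_facts` — **in the (F1) regime, from a stage `s` of `S(X, ν)` reached from a maximal
origin at level `3` which is ISOLATED in the Hilbert–Samuel locus with `e ≤ 1`, NO chain of canonical near steps is blown
up infinitely often** (res-L1-w42-lead-1's re-cut socket `IsoLowDirDimTerminatesQM`, the `hlow` input of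
`wlow3CharM_assembledQ`), CONDITIONAL on the binders of record `CossartJannsenSaito2020_thm_3_14` (p499700),
`CossartJannsenSaito2020_thm_3_10_4` (p499783), `Thm314_point_locus` + `ProjDir_line` (p503241), `Corollary637_char`, and
the two LIB-shaped `∀`-binders (EXC) «a blow-up of an excellent scheme is excellent», (ISO-pt) «`InducesIsoOn π {x'} {x}` at
a `k(x)`-rational closed point `x'`» (see `…Corridor3WLadderGradeOneUnitsTower`).

Steps: `e = 0` at `s` ⇒ no blow-up of the marked point ever again (`noMovingNearChainFrom_of_dirDim_eq_zero_of_thm_3_14`);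
`ν = Φ^{(3)}` ⇒ an isolated marked point has `ē = 0` (`geomDirDim_eq_zero_of_iso_of_hsFun_eq_Phi`); else `e = 1` at `s`
PROPAGATES along the chain (`Moving.dirDim_le_one_of_chain`: waiting steps keep `e`; at a genuine step the next marked
point, read on the blow-up of `Spec 𝒪_{X_n,x_n}` at its closed point, lies on `ℙ(Dir)` — Thm. 3.14 — hence is
`k(x_n)`-rational — `ℙ(Dir) ≅ ℙ^0` — so `e` does not go up — Thm. 3.10 (4), tree
`dirDim_le_of_hsFun_eq_of_isIso_residueFieldMap`), the chain is re-based at `s` (`exists_chain_from_of_reaches`), and the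
local tower of its genuine stages is an infinite fundamental sequence at a point isolated in the Hilbert–Samuel locus with
`e = 1`, contradicting Cor. 6.37 (`false_of_localTower_grade_one`).

## References

* V. Cossart, U. Jannsen, S. Saito, LNM 2270 (2020): Thm. 3.10 (4), Thm. 3.14, Def. 6.34, Cor. 6.37, p. 103, p. 107.
  [CossartJannsenSaito2020]
-/

noncomputable section

-- namespace `…Corridor3.Moving` re-enters `…Corridor3` (module convention of the Moving files)
set_option linter.dupNamespace false

open CategoryTheory CategoryTheory.Limits AlgebraicGeometry TopologicalSpace IsLocalRing
open Literature.AlgebraicGeometry.Resolution Literature.RingTheory.HilbertSamuel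
open Scheme.IdealSheafData

universe u

open Summit.ResolutionOfSingularities.ResolutionOfSingularities.Theorems.CampaignW42
open Literature.AlgebraicGeometry.CossartJannsenSaito2020
open Summit.ResolutionOfSingularities.ResolutionOfSingularities.Theorems.SigmaMaxModificationsCorridor3

namespace Summit.ResolutionOfSingularities.ResolutionOfSingularities.Theorems.SigmaMaxModificationsCorridor3.Moving

variable {R : ∀ S : Scheme.{u}, CentreSeq S → Prop} {N : ℕ} {ν : ℕ → ℕ}

/-! ## Re-basing a chain at an earlier stage -/

/-- **A moving chain from a stage reached from `s` extends to a moving chain starting AT `s`** (prepend the finite path).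
[folklore] -/
theorem exists_chain_from_of_reaches {s t : MarkedStage.{u}} (h : Reaches R N ν s t) {c : ℕ → MarkedStage.{u}}
    (h0 : c 0 = t) (hstep : ∀ n, CanonicalNearStep R N ν (c n) (c (n + 1)))
    (hmov : ∀ n, ∃ m, n ≤ m ∧ (c m).IsBlownUp R N ν) :
    ∃ c' : ℕ → MarkedStage.{u}, c' 0 = s ∧ (∀ n, CanonicalNearStep R N ν (c' n) (c' (n + 1))) ∧
      ∀ n, ∃ m, n ≤ m ∧ (c' m).IsBlownUp R N ν := by
  induction h using Relation.ReflTransGen.head_induction_on generalizing c with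
  | refl => exact ⟨c, h0, hstep, hmov⟩
  | @head a a' hst _ ih =>
    obtain ⟨c', hc'0, hstep', hmov'⟩ := ih h0 hstep hmov
    refine ⟨fun n => Nat.rec (motive := fun _ => MarkedStage.{u}) a (fun m _ => c' m) n, rfl, fun n => ?_, fun n => ?_⟩
    · cases n with
      | zero =>
        show CanonicalNearStep R N ν a (c' 0)
        rw [hc'0]; exact hst
      | succ n => exact hstep' n
    · obtain ⟨m, hm, hb⟩ := hmov' n
      exact ⟨m + 1, by omega, hb⟩

/-! ## `e ≤ 1` propagates along the chain (Thm. 3.14 + `ℙ(Dir) ≅ ℙ⁰` + Thm. 3.10 (4), on the local blow-up) -/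

/-- **At a GENUINE step from a marked point with `e = 1`, the next marked point has `e ≤ 1`** (good state, (F1),
`ν ≠ Φ^{(3)}`; modulo the binders): on the blow-up of `Spec 𝒪_{X_n,x_n}` at its closed point the lift of `x_{n+1}` is near,
hence on `ℙ(Dir)` (Thm. 3.14), hence `k(x_n)`-rational (`ℙ(Dir) ≅ ℙ⁰`), hence `e` does not go up (Thm. 3.10 (4)).
[cite: CossartJannsenSaito2020, Thm. 3.14, Thm. 3.10 (4), p. 103] -/
theorem dirDim_le_one_of_genuineStep (h314 : CossartJannsenSaito2020_thm_3_14.{u})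
    (h3104 : CossartJannsenSaito2020_thm_3_10_4.{u}) (h314pt : Thm314_point_locus.{u}) (hline : ProjDir_line.{u})
    (hRf : OracleFunctional R) (hRa : OracleAdmissible R) {p : ℕ} {X : Scheme.{u}} [IsLocallyNoetherian X] {x : X}
    (hX : IsMaximalOrigin p 3 ν X x) (hq : Helpers.QCharRegime p 3 ν X x) (hν : ν ≠ iterPSum 3 Phi)
    {s s' : MarkedStage.{u}} (hreach : Reaches R 3 ν (MarkedStage.init X x) s) (hst : CanonicalNearStep R 3 ν s s')
    (hb : s.IsBlownUp R 3 ν) (he : dirDim s = 1) : dirDim s' ≤ 1 := by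
  haveI : IsLocallyNoetherian s.W := s.ln
  obtain ⟨k, _, _, f, -, hft, hqc⟩ := hX.exists_structure
  haveI := hft
  haveI := hqc
  haveI := hX.isReduced
  have hgood : StateGood k R 3 ν s.W s.L s.P :=
    stateGood_of_reaches (stateGood_init_general hRa f hX.dim_le hX.maximal hν) hreach
  have hpt : s.pt ∈ Scheme.hsStratum s.W 3 ν := pt_mem_hsStratum_of_reaches hX.mem_stratum hreach
  have hpt' : s'.pt ∈ Scheme.hsStratum s'.W 3 ν := hst.pt_mem_hsStratum
  obtain ⟨C, x', hC, hmax, hπ, -, hiso⟩ := exists_genuineStep h314 hRf hRa hX hq hν hreach hst hb he.le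
  -- read on the blow-up `P → Spec 𝒪_{X_n,x_n}` of the closed point
  haveI : IsLocallyNoetherian (blowup C) := CentreSeq.isLocallyNoetherian_blowup C
  haveI := isLocallyNoetherian_pullback_fromSpecStalk (blowup.isBlowup C) s.pt
  have hc : (s.W.fromSpecStalk s.pt).base (closedPoint (s.W.presheaf.stalk s.pt)) = s.pt := Scheme.fromSpecStalk_closedPoint
  have hP := isBlowup_pullback_snd_fromSpecStalk_singleton (blowup.isBlowup C) hC hmax hc
  obtain ⟨y, hy, hyc, hyiso⟩ := exists_lift_pullback_fromSpecStalk (blowup.π C) s.pt hπ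
  have hyc' : (pullback.snd (blowup.π C) (s.W.fromSpecStalk s.pt)).base y = closedPoint (s.W.presheaf.stalk s.pt) :=
    eq_closedPoint_of_fromSpecStalk_eq hyc
  -- the setting on `Spec 𝒪`
  have hexc : Scheme.IsExcellent (Spec (s.W.presheaf.stalk s.pt)) :=
    Scheme.isExcellent_Spec_of_isExcellentRing _ (isExcellentRing_stalk_of_isExcellent hgood.isExcellent s.pt)
  have hdimO : topologicalKrullDim ↥(Spec (s.W.presheaf.stalk s.pt)) ≤ ((3 : ℕ) : WithBot ℕ∞) :=
    ((s.W.fromSpecStalk s.pt).isEmbedding.isInducing.topologicalKrullDim_le).trans hgood.dim_le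
  have heO : Scheme.dirDim (Spec (s.W.presheaf.stalk s.pt)) (closedPoint (s.W.presheaf.stalk s.pt)) = 1 := by
    rw [Scheme.dirDim_fromSpecStalk_closedPoint]; exact he
  have hpermO : IdealSheafData.IsPermissible
      (vanishingIdeal (⟨{(closedPoint (s.W.presheaf.stalk s.pt) : ↥(Spec (s.W.presheaf.stalk s.pt)))},
        isClosed_singleton_of_fromSpecStalk_eq hc⟩ : Closeds ↥(Spec (s.W.presheaf.stalk s.pt)))) :=
    isPermissible_singleton_of_one_le_dirDim _ heO.symm.le
  have hcharO : CharHypothesis (Spec (s.W.presheaf.stalk s.pt)) (closedPoint (s.W.presheaf.stalk s.pt)) := by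
    let T₀ : BlowupTower.{u} :=
      { X := fun _ => s.W, ln := fun _ => s.ln, C := fun _ => ∅, isClosed_C := fun _ => isClosed_empty,
        π := fun _ => 𝟙 s.W, isBlowup := fun _ => isBlowup_id_vanishingIdeal_empty s.W }
    exact T₀.charHypothesis_localize s.pt (charHypothesis_of_qCharRegime hX hq hreach hgood)
  -- the lift is near, hence on `ℙ(Dir)`, hence rational
  haveI : IsLocallyNoetherian s'.W := s'.ln
  have hnearW : Scheme.hsFun (blowup C) 3 x' = Scheme.hsFun s.W 3 s.pt := by
    obtain ⟨e⟩ := hiso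
    rw [hsFun_eq_of_stalkIso e, Scheme.mem_hsStratum_iff.mp hpt', Scheme.mem_hsStratum_iff.mp hpt]
  have hnear := hsFun_lift_eq_hsFun_closedPoint (blowup.π C) s.pt 3 hy hnearW
  have hmemsupp : (pullback.snd (blowup.π C) (s.W.fromSpecStalk s.pt)).base y ∈
      ((vanishingIdeal (⟨{(closedPoint (s.W.presheaf.stalk s.pt) : ↥(Spec (s.W.presheaf.stalk s.pt)))},
        isClosed_singleton_of_fromSpecStalk_eq hc⟩ : Closeds ↥(Spec (s.W.presheaf.stalk s.pt)))).support : Set _) := by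
    rw [Scheme.IdealSheafData.coe_support_vanishingIdeal]; exact hyc'
  have hon : IsOnProjDirectrix (pullback.snd (blowup.π C) (s.W.fromSpecStalk s.pt)) y :=
    h314pt _ _ _ _ _ 3 y hexc hpermO hP hdimO hyc' hcharO (by rw [hnear])
  haveI : IsIso ((pullback.snd (blowup.π C) (s.W.fromSpecStalk s.pt)).residueFieldMap y) :=
    (hline _ _ _ _ _ hP heO).2 y ((mem_projDirectrixFibre _ _ _).mpr ⟨hyc', hon⟩)
  have hle := dirDim_le_of_hsFun_eq_of_isIso_residueFieldMap h3104 hexc hpermO hP hdimO hmemsupp (by rw [hnear, hyc'])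
  -- back to the chain
  rw [hyc', heO, dirDim_lift_eq, hy] at hle
  obtain ⟨e⟩ := hiso
  show Scheme.dirDim s'.W s'.pt ≤ 1
  rw [← dirDim_eq_of_stalkIso e]
  exact hle

/-- **`e ≤ 1` PROPAGATES along a chain from a stage with `e ≤ 1`** (maximal origin, (F1), `ν ≠ Φ^{(3)}`; modulo the
binders): waiting steps keep `e`; a genuine step at `e = 0` has no next marked point; at `e = 1` the previous theorem.
[cite: CossartJannsenSaito2020, Thm. 3.14, Thm. 3.10 (4)] -/
theorem dirDim_le_one_of_chain (h314 : CossartJannsenSaito2020_thm_3_14.{u})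
    (h3104 : CossartJannsenSaito2020_thm_3_10_4.{u}) (h314pt : Thm314_point_locus.{u}) (hline : ProjDir_line.{u})
    (hRf : OracleFunctional R) (hRa : OracleAdmissible R) {p : ℕ} {X : Scheme.{u}} [IsLocallyNoetherian X] {x : X}
    (hX : IsMaximalOrigin p 3 ν X x) (hq : Helpers.QCharRegime p 3 ν X x) (hν : ν ≠ iterPSum 3 Phi)
    {c : ℕ → MarkedStage.{u}} (h0 : Reaches R 3 ν (MarkedStage.init X x) (c 0))
    (hstep : ∀ n, CanonicalNearStep R 3 ν (c n) (c (n + 1))) (he : dirDim (c 0) ≤ 1) (n : ℕ) : dirDim (c n) ≤ 1 := by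
  induction n with
  | zero => exact he
  | succ n ih =>
    by_cases hb : (c n).IsBlownUp R 3 ν
    · rcases Nat.lt_or_ge (dirDim (c n)) 1 with h0' | h1
      · exact (false_of_isBlownUp_of_dirDim_eq_zero (theorem314_dim_lt_dirDim_of_thm_3_14 h314) hRf hRa hX hq
          (reaches_chain h0 hstep n) hb (hstep n) (by omega)).elim
      · exact dirDim_le_one_of_genuineStep h314 h3104 h314pt hline hRf hRa hX hq hν (reaches_chain h0 hstep n) (hstep n)
          hb (le_antisymm ih h1)
    · rw [dirDim_eq_of_step_of_not_isBlownUp (hstep n) hb]; exact ih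

/-! ## The socket -/

/-- **THE THIRD-DOOR SOCKET `IsoLowDirDimTerminatesQM p`, modulo the binders** (see the module docstring): in the (F1)
regime, from a stage of `S(X, ν)` reached from a maximal origin at level `3`, isolated in the Hilbert–Samuel locus and
with `e ≤ 1`, no chain of canonical near steps is blown up infinitely often.
[cite: CossartJannsenSaito2020, Cor. 6.37, Thm. 3.14, Thm. 3.10 (4), Def. 6.34, p. 107] -/
theorem isoLowDirDimTerminatesQM_of_facts (h314 : CossartJannsenSaito2020_thm_3_14.{0})
    (h3104 : CossartJannsenSaito2020_thm_3_10_4.{0}) (h314pt : Thm314_point_locus.{0}) (hline : ProjDir_line.{0})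
    (hC637 : Corollary637_char.{0})
    (hEXC : ∀ {Y Y' : Scheme.{0}} [IsLocallyNoetherian Y] {π : Y' ⟶ Y} {I : Y.IdealSheafData},
      IsBlowup π I → Scheme.IsExcellent Y → Scheme.IsExcellent Y')
    (hISO : ∀ {Y Y' : Scheme.{0}} (π : Y' ⟶ Y) {y' : Y'} {y : Y} (hy' : IsClosed ({y'} : Set Y'))
      (hy : IsClosed ({y} : Set Y)), π.base y' = y → IsIso (π.residueFieldMap y') → InducesIsoOn π {y'} hy' {y} hy)
    (p : ℕ) : IsoLowDirDimTerminatesQM p := by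
  intro R hRf hRa ν X _ x hX hq s hreach hiso hes
  rintro ⟨c, hc0, hstep, -, hmov⟩
  haveI : IsLocallyNoetherian s.W := s.ln
  have hpts : s.pt ∈ Scheme.hsStratum s.W 3 ν := pt_mem_hsStratum_of_reaches hX.mem_stratum hreach
  rcases Nat.lt_or_ge (dirDim s) 1 with hes0 | hes1
  · -- `e = 0`: the marked point is never blown up again
    exact noMovingNearChainFrom_of_dirDim_eq_zero_of_thm_3_14 h314 hRf hRa hX hq hreach (by omega) (fun _ => True)
      ⟨c, hc0, hstep, fun _ => trivial, hmov⟩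
  have hes1 : dirDim s = 1 := le_antisymm hes hes1
  by_cases hν : ν = iterPSum 3 Phi
  · -- `ν = Φ^{(3)}`: an isolated marked point has `ē = 0 < 1 = e ≤ ē`
    have h0 := geomDirDim_eq_zero_of_iso_of_hsFun_eq_Phi hiso ((Scheme.mem_hsStratum_iff.mp hpts).trans hν)
    have h1 := dirDim_le_geomDirDim s
    rw [hes1, MarkedStage.geomDirDim] at h1
    omega
  -- re-base the chain at `s`, propagate `e ≤ 1`, build the local tower, contradict Cor. 6.37
  obtain ⟨k, _, _, f, -, hft, hqc⟩ := hX.exists_structure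
  haveI := hft
  haveI := hqc
  haveI := hX.isReduced
  obtain ⟨c', hc'0, hstep', hmov'⟩ := exists_chain_from_of_reaches hc0 (c := c) rfl hstep hmov
  have h0' : Reaches R 3 ν (MarkedStage.init X x) (c' 0) := by rw [hc'0]; exact hreach
  have hreach' : ∀ n, Reaches R 3 ν (MarkedStage.init X x) (c' n) := reaches_chain h0' hstep'
  have hgood : ∀ n, StateGood k R 3 ν (c' n).W (c' n).L (c' n).P := fun n =>
    stateGood_of_reaches (stateGood_init_general hRa f hX.dim_le hX.maximal hν) (hreach' n)
  haveI : ∀ n, IsLocallyNoetherian (c' n).W := fun n => (c' n).ln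
  have hpt : ∀ n, (c' n).pt ∈ Scheme.hsStratum (c' n).W 3 ν := fun n => pt_mem_hsStratum_of_reaches hX.mem_stratum (hreach' n)
  have hEle : ∀ n, dirDim (c' n) ≤ 1 := dirDim_le_one_of_chain h314 h3104 h314pt hline hRf hRa hX hq hν h0' hstep'
    (by rw [hc'0]; exact hes1.le)
  have hE1 : ∀ n, (c' n).IsBlownUp R 3 ν → dirDim (c' n) = 1 := by
    intro n hb
    rcases Nat.lt_or_ge (dirDim (c' n)) 1 with hlt | hge
    · exact (false_of_isBlownUp_of_dirDim_eq_zero (theorem314_dim_lt_dirDim_of_thm_3_14 h314) hRf hRa hX hq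
        (hreach' n) hb (hstep' n) (by omega)).elim
    · exact le_antisymm (hEle n) hge
  obtain ⟨g, T, y, -, hgb, -, hwait, hC, hycl, hover, hstalk, hkey, hchar, hisol⟩ :=
    exists_localTower_of_movingChain_wait h314 hRf hRa hX hq hν h0' hstep' hmov' fun n _ => hEle n
  haveI : ∀ j, IsLocallyNoetherian (T.X j) := T.ln
  have hH : ∀ j, Scheme.hsFun (T.X j) 3 (y j) = Scheme.hsFun (T.X 0) 3 (y 0) := by
    intro j
    obtain ⟨ej⟩ := hstalk j
    obtain ⟨e0⟩ := hstalk 0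
    rw [hsFun_eq_of_stalkIso ej, hsFun_eq_of_stalkIso e0, Scheme.mem_hsStratum_iff.mp (hpt _),
      Scheme.mem_hsStratum_iff.mp (hpt _)]
  have he : ∀ j, @Scheme.dirDim (T.X j) (T.ln j) (y j) = 1 := by
    intro j
    obtain ⟨ej⟩ := hstalk j
    rw [dirDim_eq_of_stalkIso ej]
    exact hE1 _ (hgb j)
  have hp' : ∀ j, ringChar (ResidueField ((T.X j).presheaf.stalk (y j))) =
      ringChar (ResidueField ((T.X 0).presheaf.stalk (y 0))) := by
    intro j
    obtain ⟨ej⟩ := hstalk j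
    obtain ⟨e0⟩ := hstalk 0
    obtain ⟨fj, -, -⟩ := (hgood (g j)).overField
    obtain ⟨f0, -, -⟩ := (hgood (g 0)).overField
    rw [ringChar_residueField_eq_of_stalkIso ej, ringChar_residueField_eq_of_stalkIso e0,
      ringChar_residueField_eq fj, ringChar_residueField_eq f0]
  have hkey3 : KeySetting T 3 :=
    hkey 3 (hgood (g 0)).isExcellent (dim_le_of_reaches (hreach' (g 0)) (d := 3) hX.dim_le)
  have hchar0 : CharHypothesis (T.X 0) (y 0) :=
    hchar (charHypothesis_of_qCharRegime hX hq (hreach' (g 0)) (hgood (g 0)))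
  have hisol0 : @IsIsolatedInHSMaxLocus (T.X 0) (T.ln 0) 3 (y 0) := by
    apply hisol 3
    let T₀ : BlowupTower.{0} :=
      { X := fun _ => (c' 0).W, ln := fun _ => (c' 0).ln, C := fun _ => ∅, isClosed_C := fun _ => isClosed_empty,
        π := fun _ => 𝟙 (c' 0).W, isBlowup := fun _ => isBlowup_id_vanishingIdeal_empty (c' 0).W }
    obtain ⟨f₀, hf₀, -⟩ := (hgood 0).overField
    haveI := hf₀
    have hsc : ∀ w : (c' 0).W, w ⤳ (c' 0).pt → Scheme.hsFun (c' 0).W 3 w ≤ Scheme.hsFun (c' 0).W 3 (c' 0).pt :=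
      fun w hw => Scheme.hsFun_le_hsFun_of_specializes_over_field f₀ 3 hw
    have hiso' : @IsIsolatedInHSMaxLocus (c' 0).W (c' 0).ln 3 (c' 0).pt := by rw [hc'0]; exact hiso
    have h1 : IsIsolatedInHSMaxLocus (Spec ((c' 0).W.presheaf.stalk (c' 0).pt)) 3
        (closedPoint ((c' 0).W.presheaf.stalk (c' 0).pt)) := T₀.isIsolatedInHSMaxLocus_localize (c' 0).pt 3 hsc hiso'
    obtain ⟨ew⟩ := nonempty_stalkIso_of_waiting hstep' (a := 0) (b := g 0) (Nat.zero_le _)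
      (fun m _ hm => hwait m hm)
    exact isIsolatedInHSMaxLocus_spec_of_iso ew 3 h1
  exact false_of_localTower_grade_one h314pt hline hC637 hEXC hISO T y hC hycl hover hkey3 hchar0 hisol0 hH he hp'

end Summit.ResolutionOfSingularities.ResolutionOfSingularities.Theorems.SigmaMaxModificationsCorridor3.Moving

end
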